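import Summits.ABC.IUTFork.Thm311RealInd2IsmIsometry
import HarnessLib

/-!
# [IUTchIII] Thm. 3.11 (i) (Ind2), print-literal at `𝕍^non`: PRINT'S Ism ACTS ON `K_v` AS A `p`-ADIC UNIT SCALAR —
# every realised `G_v`-isometry is `x ↦ c·x` for ONE `c ∈ ℤ_p^×`

PROOF-ONLY file (abc-iut cell, WAVE-5 seat abc-iut-w5-d216 gen 4; TEAM R indFixes thread × abc-iut-c312-1's R8 «print's
nonarchimedean Ism»; sequel of `Thm311RealInd2IsmIsometry`); TAKES NO SIDE on [IUTchIII] Cor. 3.12.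

abc-iut-c312-1 proved the «scalar MODULO every `n`» form (`exists_zsmul_add_nsmul_of_mem_ismIsmOf`: for `ψ` in print's
(Ind2)-group at `v`, every unit `u` and every `n ≠ 0`, `ψ(log u) = k·log u + n·log u'` with `k ∈ ℤ`) and wrote in prose
«for `Λ ≅ ℤ_p^d` a SCALAR».  THIS FILE proves the scalar statement in the kernel, for the ANALYTIC logarithm
(`LogvAnalyticAt p logv`), on abc-iut-S7's rescaled completion `K_v^{(1/n_v)}` (a normed `ℚ_p`-algebra):

* `exists_int_smul_dist_lt_of_mem_ismIsmOf` — `ψ(log u)` is a LIMIT of integer multiples of `log u`: for every `ε > 0`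
  some `k ∈ ℤ` has `‖ψ(log u) − k·log u‖' < ε` (take `n = p^m`: `‖p^m·log u'‖' ≤ p^{−m}·B`, `B` a bound for the compact
  `log_p(𝒪^×)`, `Thm311RealInd2IsmIsometry.exists_bound_norm_logv`);
* `exists_padic_smul_eq_of_mem_ismIsmOf` — hence `ψ(log u) = c_u·log u` for some `c_u ∈ ℚ_p` (the line `ℚ_p·log u` is
  closed: Mathlib `isClosedMap_smul_left`);
* **`exists_unit_scalar_of_mem_ismIsm`** — for `ψ ∈ Real.ismIsm logv v` (c312-1's `ℚ`-linear carrier reading; `ℚ_p`-linear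
  by continuity, c312-5 `padicLinearOf`): there is ONE `c ∈ ℚ_p` with `‖c‖ = 1` and `ψ(a) = c·a` for ALL `a ∈ K_v`.
  (The `c_u` agree: two units with dependent logs by `ℚ_p`-linearity, with independent logs through `log(u₀u) =
  log u₀ + log u`; every `a ≠ 0` has `p^N·a = log u` for some unit, `exists_unit_logv_eq_of_norm_le`; `‖c‖ = 1` by the
  isometry theorem `norm_of_map_eq_of_mem_ismIsmOf`.)
* `image_eq_of_mem_ismIsm_of_smul_mem` — hence print's (Ind2) at `v` maps onto itself EVERY subset of `K_v` stable under
  the unit scalars `ℤ_p^×` (every ball, every `𝒪_v`-submodule, every `ℤ_p`-lattice — in particular every region the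
  identified-copies / hull arguments of record test).

Reading for the adjudication record (§A (Ind2) slot / §R, neutral, about OUR typings): on `K_v` print's (Ind2), as typed
by c312-1 (realisations through the analytic log of [IUTchII] Ex. 1.8 (iv) `G_v`-isometries), is contained in the scalar
group `ℤ_p^×·id` — the image Mochizuki names («`Ẑ^× ↠ ℤ_p^× ↪ Ism`»; c312-1's `Thm311RealInd2IsmZHat` realises every
`χ_p(û)`, so the containment is an equality up to the log binder); Dupuy–Hilado's `Aut_{ℚ_p}(K_v : I_v)` (c312-5
`Real.ismDH`) is `GL_{ℤ_p}(I_v)`.  Every (Ind2)-driven MOVER of the cell's record (lattice shears, hull inflation,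
non-isometries, ball movers) lies in the difference.  Nothing here asserts that abc is proved or refuted; (Ind1), the log
binder, and Cor. 3.12 itself are untouched; print's «compact topological group Ism(G)» is read with topologies suppressed
as abc-iut-L6-t2 typed it.  [claim: Mochizuki2012, status: disputed] for every [IUTchII]/[IUTchIII] quotation;
[cite: SerreLocalFields1979, Ch. XIV §6 Thm. 1]; [cite: NeukirchANT1999, Ch. II Prop. (5.5)]; [cite: DupuyHilado2025, §4.9].
Axioms: standard three.
-/

set_option autoImplicit false

noncomputable section

open Metric Set

namespace Summit.ABC.IUTFork.Thm311.Real

open NumberField IsDedekindDomain Literature.IUT.LogVolume Literature.IUT.LogThetaLattice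
open Literature.NumberTheory.NumberFields

variable {F : Type} [Field F] [NumberField F] (p : ℕ) [hp : Fact p.Prime] (v : HeightOneSpectrum (𝓞 F))
  (hv : ((p : ℕ) : 𝓞 F) ∈ v.asIdeal) {logv : PadicLogs F} (hlog : LogvAnalyticAt p logv)

/-! ## 1. `ψ(log u)` lies on the `ℚ_p`-line through `log u` -/

include hlog in
/-- **`ψ(log_v u)` is a limit of INTEGER multiples of `log_v u`**: for `ψ` in print's (Ind2)-group at `v`, a unit `u` and
`ε > 0`, some `k ∈ ℤ` has `‖ψ(log_v u) − k·log_v u‖' < ε` (abc-iut-c312-1's scalar-mod-`p^m` form, the remainder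
`p^m·log_v u'` having norm `≤ p^{−m}·B`). [cite: SerreLocalFields1979, Ch. XIV §6 Thm. 1] [claim: Mochizuki2012, status: disputed] -/
theorem exists_int_smul_dist_lt_of_mem_ismIsmOf {ψ : v.adicCompletion F ≃+ v.adicCompletion F}
    (hψ : ψ ∈ ismIsmOf v (logv v)) (u : (↥(integers v))ˣ) {ε : ℝ} (hε : 0 < ε) :
    ∃ k : ℤ, ‖RescaledCompletion.of F p v hv (ψ (logv v (Additive.ofMul u))) -
      (k : ℚ_[p]) • RescaledCompletion.of F p v hv (logv v (Additive.ofMul u))‖ < ε := by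
  obtain ⟨B, hB1, hB⟩ := exists_bound_norm_logv p v hv hlog
  have hBpos : 0 < B := lt_of_lt_of_le one_pos hB1
  have hp1 : ((p : ℝ)⁻¹) < 1 := inv_lt_one_of_one_lt₀ (by exact_mod_cast hp.out.one_lt)
  have hp0 : 0 ≤ ((p : ℝ)⁻¹) := inv_nonneg.mpr (by exact_mod_cast hp.out.pos.le)
  obtain ⟨m, hm⟩ := exists_pow_lt_of_lt_one (div_pos hε hBpos) hp1
  have hpm : p ^ m ≠ 0 := pow_ne_zero m hp.out.ne_zero
  -- c312-1's scalar-mod-`p^m` form, read with c312-5's unit type (`integers v = adicCompletionIntegers` by `rfl`)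
  have key : ∀ u₁ : (↥(integers v))ˣ, ∃ (k : ℤ) (u' : (↥(integers v))ˣ),
      ψ (logv v (Additive.ofMul u₁)) = k • logv v (Additive.ofMul u₁) + (p ^ m) • logv v (Additive.ofMul u') :=
    fun u₁ => exists_zsmul_add_nsmul_of_mem_ismIsmOf (logv v) hψ hpm u₁
  obtain ⟨k, u', hk⟩ := key u
  refine ⟨k, ?_⟩
  have hBu' : ‖RescaledCompletion.of F p v hv (logv v (Additive.ofMul u'))‖ ≤ B := hB u'
  -- read the two logs in Mathlib's `adicCompletion` (c312-5's `Carrier (inr v)` by `rfl`) so that `rw` applies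
  set Lu : v.adicCompletion F := logv v (Additive.ofMul u) with hLu_def
  set Lu' : v.adicCompletion F := logv v (Additive.ofMul u') with hLu'_def
  -- `hk`'s right-hand side carries c312-5's carrier instances; `map_add` is applied by unification, not by `rw`
  have hk' : RescaledCompletion.of F p v hv (ψ Lu) =
      RescaledCompletion.of F p v hv (k • Lu) + RescaledCompletion.of F p v hv ((p ^ m) • Lu') := by
    rw [hk]
    exact map_add (RescaledCompletion.of F p v hv) (k • Lu) ((p ^ m) • Lu')
  have hrw : RescaledCompletion.of F p v hv (ψ Lu) - (k : ℚ_[p]) • RescaledCompletion.of F p v hv Lu =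
      RescaledCompletion.of F p v hv ((p ^ m) • Lu') := by
    rw [hk', map_zsmul, Int.cast_smul_eq_zsmul, add_sub_cancel_left]
  rw [hrw, norm_of_nsmul_pow p v hv m Lu']
  calc ((p : ℝ)⁻¹) ^ m * ‖RescaledCompletion.of F p v hv Lu'‖
      ≤ ((p : ℝ)⁻¹) ^ m * B := mul_le_mul_of_nonneg_left hBu' (pow_nonneg hp0 m)
    _ < ε := by
        have h := mul_lt_mul_of_pos_right hm hBpos
        rw [div_mul_cancel₀ ε hBpos.ne'] at h
        exact h

include hlog in
/-- **`ψ(log_v u) = c_u · log_v u` for some `c_u ∈ ℚ_p`**: the line `ℚ_p·log_v u ⊆ K_v^{(1/n_v)}` is closed (Mathlib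
`isClosedMap_smul_left`) and `ψ(log_v u)` lies in its closure. [cite: SerreLocalFields1979, Ch. XIV §6 Thm. 1]
[claim: Mochizuki2012, status: disputed] -/
theorem exists_padic_smul_eq_of_mem_ismIsmOf {ψ : v.adicCompletion F ≃+ v.adicCompletion F}
    (hψ : ψ ∈ ismIsmOf v (logv v)) (u : (↥(integers v))ˣ) :
    ∃ c : ℚ_[p], RescaledCompletion.of F p v hv (ψ (logv v (Additive.ofMul u))) =
      c • RescaledCompletion.of F p v hv (logv v (Additive.ofMul u)) := by
  set x := RescaledCompletion.of F p v hv (logv v (Additive.ofMul u)) with hx_def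
  have hclosed : IsClosed (Set.range fun c : ℚ_[p] => c • x) := (isClosedMap_smul_left x).isClosed_range
  have hmem : RescaledCompletion.of F p v hv (ψ (logv v (Additive.ofMul u))) ∈ closure (Set.range fun c : ℚ_[p] => c • x) := by
    rw [Metric.mem_closure_iff]
    intro ε hε
    obtain ⟨k, hk⟩ := exists_int_smul_dist_lt_of_mem_ismIsmOf p v hv hlog hψ u hε
    exact ⟨(k : ℚ_[p]) • x, ⟨(k : ℚ_[p]), rfl⟩, by rw [dist_eq_norm]; exact hk⟩
  rw [hclosed.closure_eq] at hmem
  obtain ⟨c, hc⟩ := hmem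
  exact ⟨c, hc.symm⟩

/-! ## 2. One scalar for all of `K_v` -/

include hlog in
/-- **PRINT'S (Ind2) AT `v` ACTS ON `K_v` AS A `p`-ADIC UNIT SCALAR**: for every `ψ ∈ Real.ismIsm logv v` (`logv` analytic
at `p`) there is `c ∈ ℚ_p` with `‖c‖ = 1` such that `ψ(a) = c·a` for ALL `a ∈ K_v` (read in `K_v^{(1/n_v)}`, a normed
`ℚ_p`-algebra).  The scalars `c_u` of `exists_padic_smul_eq_of_mem_ismIsmOf` agree (`ℚ_p`-linearity of `ψ`, c312-5
`padicLinearOf`; `log_v(u₀u) = log_v u₀ + log_v u` for independent logs); every `a ≠ 0` has `p^N·a = log_v u` for a unit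
(`exists_unit_logv_eq_of_norm_le`); `‖c‖ = 1` by `norm_of_map_eq_of_mem_ismIsmOf`. [cite: SerreLocalFields1979, Ch. XIV §6 Thm. 1]
[cite: NeukirchANT1999, Ch. II Prop. (5.5)] [claim: Mochizuki2012, status: disputed] -/
theorem exists_unit_scalar_of_mem_ismIsm {ψ : Carrier (.inr v : Place F) ≃ₗ[ℚ] Carrier (.inr v : Place F)}
    (hψ : ψ ∈ ismIsm logv v) :
    ∃ c : ℚ_[p], ‖c‖ = 1 ∧ ∀ a : Carrier (.inr v : Place F),
      RescaledCompletion.of F p v hv (ψ a) = c • RescaledCompletion.of F p v hv a := by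
  have hψ' := (mem_ismIsm_iff logv v ψ).mp hψ
  have hcont : Continuous ψ := hψ'.1
  -- `ψ` read `ℚ_p`-linearly on the rescaled completion
  let ψK := padicLinearOf p v hv ψ hcont
  have hψK : ∀ a : Carrier (.inr v : Place F), ψK (RescaledCompletion.of F p v hv a) = RescaledCompletion.of F p v hv (ψ a) :=
    fun a => rfl
  -- the logs of units, read in the rescaled completion, and their scalars
  let xOf : (↥(integers v))ˣ → RescaledCompletion F p v hv := fun u => RescaledCompletion.of F p v hv (logv v (Additive.ofMul u))
  have hxψ : ∀ u, ψK (xOf u) = RescaledCompletion.of F p v hv (ψ (logv v (Additive.ofMul u))) := fun u => rfl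
  have hcu : ∀ u, ∃ c : ℚ_[p], ψK (xOf u) = c • xOf u := fun u => by
    obtain ⟨c, hc⟩ := exists_padic_smul_eq_of_mem_ismIsmOf p v hv hlog hψ' u
    exact ⟨c, hc⟩
  have hxmul : ∀ u₁ u₂, xOf (u₁ * u₂) = xOf u₁ + xOf u₂ := fun u₁ u₂ => by
    show RescaledCompletion.of F p v hv (logv v (Additive.ofMul (u₁ * u₂))) =
      RescaledCompletion.of F p v hv (logv v (Additive.ofMul u₁)) +
        RescaledCompletion.of F p v hv (logv v (Additive.ofMul u₂))
    rw [ofMul_mul, map_add]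
    exact map_add (RescaledCompletion.of F p v hv) _ _
  -- a unit `u₀` with `log_v u₀ = p² ≠ 0`
  have hp2norm : ‖RescaledCompletion.of F p v hv ((p ^ 2 : ℕ) : v.adicCompletion F)‖ ≤ (p : ℝ) ^ (-(2 : ℝ)) := by
    rw [map_natCast, Nat.cast_pow, norm_pow, norm_prime p (RescaledCompletion F p v hv),
      Real.rpow_neg (by exact_mod_cast hp.out.pos.le), Real.rpow_two, inv_pow]
  obtain ⟨u₀, hu₀⟩ := exists_unit_logv_eq_of_norm_le p v hv hlog hp2norm
  have hx₀ : xOf u₀ = (p : RescaledCompletion F p v hv) ^ 2 := by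
    show RescaledCompletion.of F p v hv (logv v (Additive.ofMul u₀)) = _
    rw [hu₀, map_natCast, Nat.cast_pow]
  have hx₀ne : xOf u₀ ≠ 0 := by
    rw [hx₀]; exact pow_ne_zero 2 (prime_ne_zero p (RescaledCompletion F p v hv))
  obtain ⟨c, hc⟩ := hcu u₀
  -- the scalar of every unit with non-zero log is `c`
  have hall : ∀ u, xOf u ≠ 0 → ψK (xOf u) = c • xOf u := by
    intro u hune
    obtain ⟨cu, hcu'⟩ := hcu u
    by_cases hdep : ∃ l : ℚ_[p], xOf u = l • xOf u₀
    · obtain ⟨l, hl⟩ := hdep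
      rw [hl, map_smul, hc, smul_comm]
    · -- independent logs: compare through `u₀ * u`
      obtain ⟨c', hc'⟩ := hcu (u₀ * u)
      rw [hxmul, map_add, hc, hcu', smul_add] at hc'
      -- `(c - c') • x₀ + (cu - c') • x_u = 0`
      have hlin : (cu - c') • xOf u = (c' - c) • xOf u₀ := by
        rw [sub_smul, sub_smul]
        have := hc'
        -- c • x₀ + cu • xu = c' • x₀ + c' • xu
        rw [← sub_eq_zero] at this ⊢
        rw [← this]
        abel
      have hcu_eq : cu = c' := by
        by_contra hne
        have hne' : cu - c' ≠ 0 := sub_ne_zero.mpr hne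
        apply hdep
        refine ⟨(cu - c')⁻¹ * (c' - c), ?_⟩
        rw [mul_smul, ← hlin, smul_smul, inv_mul_cancel₀ hne', one_smul]
      have hc_eq : c = c' := by
        rw [hcu_eq, sub_self, zero_smul] at hlin
        have h0 : (c' - c) • xOf u₀ = 0 := hlin.symm
        rcases smul_eq_zero.mp h0 with h | h
        · exact (sub_eq_zero.mp h).symm
        · exact absurd h hx₀ne
      rw [hcu', hcu_eq, ← hc_eq]
  -- `‖c‖ = 1` by the isometry theorem at `x₀`
  have hnorm : ‖c‖ = 1 := by
    have hiso := norm_of_map_eq_of_mem_ismIsmOf p v hv hlog hψ' (logv v (Additive.ofMul u₀))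
    have h1 : ‖ψK (xOf u₀)‖ = ‖xOf u₀‖ := hiso
    rw [hc, norm_smul] at h1
    exact (mul_eq_right₀ (norm_ne_zero_iff.mpr hx₀ne)).mp h1
  refine ⟨c, hnorm, fun a₀ => ?_⟩
  -- read `a₀` in Mathlib's `adicCompletion` (c312-5's carrier by `rfl`) so that `rw` applies
  obtain ⟨a, ha_def⟩ : ∃ a : v.adicCompletion F, a = a₀ := ⟨a₀, rfl⟩
  have hgoal : ψK (RescaledCompletion.of F p v hv a) = RescaledCompletion.of F p v hv (ψ a₀) := ha_def ▸ hψK a₀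
  rw [← hgoal, ← ha_def]
  -- every `a ≠ 0` becomes the log of a unit after multiplication by `p^N`
  by_cases ha0 : RescaledCompletion.of F p v hv a = 0
  · rw [ha0, map_zero, smul_zero]
  have hypos : 0 < ‖RescaledCompletion.of F p v hv a‖ := norm_pos_iff.mpr ha0
  have hp1 : ((p : ℝ)⁻¹) < 1 := inv_lt_one_of_one_lt₀ (by exact_mod_cast hp.out.one_lt)
  have hp0 : 0 < ((p : ℝ)⁻¹) := inv_pos.mpr (by exact_mod_cast hp.out.pos)
  have hp2 : 0 < (p : ℝ) ^ (-(2 : ℝ)) := Real.rpow_pos_of_pos (by exact_mod_cast hp.out.pos) _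
  obtain ⟨N, hN⟩ := exists_pow_lt_of_lt_one (div_pos hp2 hypos) hp1
  have hsmall : ‖RescaledCompletion.of F p v hv ((p ^ N) • a)‖ ≤ (p : ℝ) ^ (-(2 : ℝ)) := by
    rw [norm_of_nsmul_pow p v hv N a]
    have h := mul_lt_mul_of_pos_right hN hypos
    rw [div_mul_cancel₀ _ hypos.ne'] at h
    exact h.le
  obtain ⟨u, hu⟩ := exists_unit_logv_eq_of_norm_le p v hv hlog hsmall
  have hxu : xOf u = ((p ^ N : ℕ) : ℚ_[p]) • RescaledCompletion.of F p v hv a := by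
    show RescaledCompletion.of F p v hv (logv v (Additive.ofMul u)) = _
    rw [hu, map_nsmul (RescaledCompletion.of F p v hv) (p ^ N) a, Nat.cast_smul_eq_nsmul]
  have hpN : ((p ^ N : ℕ) : ℚ_[p]) ≠ 0 := by exact_mod_cast pow_ne_zero N hp.out.ne_zero
  have hxune : xOf u ≠ 0 := by
    rw [hxu]; exact smul_ne_zero hpN ha0
  have h := hall u hxune
  rw [hxu, map_smul, smul_comm] at h
  exact smul_right_injective _ hpN h

include hv hlog in
/-- **Every `ℤ_p^×`-stable subset of `K_v` is mapped onto itself by print's (Ind2)**: if `S ⊆ K_v` satisfies `c·S ⊆ S` for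
every `c ∈ ℚ_p` with `‖c‖ = 1` (every closed ball, every `𝒪_v`-submodule, every `ℤ_p`-lattice, every region the hull /
identified-copies arguments of record test), then `ψ(S) = S` for every `ψ ∈ Real.ismIsm logv v`.
[cite: SerreLocalFields1979, Ch. XIV §6 Thm. 1] [claim: Mochizuki2012, status: disputed] -/
theorem image_eq_of_mem_ismIsm_of_smul_mem {ψ : Carrier (.inr v : Place F) ≃ₗ[ℚ] Carrier (.inr v : Place F)}
    (hψ : ψ ∈ ismIsm logv v) (S : Set (RescaledCompletion F p v hv))
    (hS : ∀ c : ℚ_[p], ‖c‖ = 1 → ∀ x ∈ S, c • x ∈ S) :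
    (fun a => toR p v hv (ψ (ofR p v hv a))) '' S = S := by
  obtain ⟨c, hc1, hc⟩ := exists_unit_scalar_of_mem_ismIsm p v hv hlog hψ
  have hc0 : c ≠ 0 := norm_ne_zero_iff.mp (by rw [hc1]; exact one_ne_zero)
  have hcinv : ‖c⁻¹‖ = 1 := by rw [norm_inv, hc1, inv_one]
  have hact : ∀ a : RescaledCompletion F p v hv, toR p v hv (ψ (ofR p v hv a)) = c • a := fun a => hc (ofR p v hv a)
  apply Set.Subset.antisymm
  · rintro _ ⟨a, ha, rfl⟩
    show toR p v hv (ψ (ofR p v hv a)) ∈ S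
    rw [hact]
    exact hS c hc1 a ha
  · intro b hb
    refine ⟨c⁻¹ • b, hS c⁻¹ hcinv b hb, ?_⟩
    show toR p v hv (ψ (ofR p v hv (c⁻¹ • b))) = b
    rw [hact, smul_smul, mul_inv_cancel₀ hc0, one_smul]

include hv in
/-- **For c312-5's analytic family** `Real.analyticLogv`: every element of print's (Ind2)-group at a finite place `v` of `F`
over `p` acts on `K_v` as a `p`-adic unit scalar. [cite: SerreLocalFields1979, Ch. XIV §6 Thm. 1]
[claim: Mochizuki2012, status: disputed] -/
theorem exists_unit_scalar_of_mem_ismIsm_analyticLogv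
    {ψ : Carrier (.inr v : Place F) ≃ₗ[ℚ] Carrier (.inr v : Place F)} (hψ : ψ ∈ ismIsm (analyticLogv F) v) :
    ∃ c : ℚ_[p], ‖c‖ = 1 ∧ ∀ a : Carrier (.inr v : Place F),
      RescaledCompletion.of F p v hv (ψ a) = c • RescaledCompletion.of F p v hv a :=
  exists_unit_scalar_of_mem_ismIsm p v hv (logvAnalyticAt_analyticLogv p) hψ

end Summit.ABC.IUTFork.Thm311.Real

end
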